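/-
Copyright (c) 2026 the pub-hodgecm-mathlib formalisation cell (harness21).  Prover seat hodgecm-mathlib-LH4-p05 (g5), req620 Track A «(D-RAM) FOUR-FRAME» squad
(unit U2H_HSide, the (ρ2b′-X) road :418; bottom socket (B): the (H)-branch kill on type (B) — seam (S-sel) of LH4-p07 (g7)'s composition).
-/
import Literature.NumberTheory.Automorphic.UnitaryTwoDescentDiscriminantRamified   -- ★ `trace_eq_smul_of_descent`, `det_eq_smul_of_descent` (any fields); brings the Valued ↔ ValuativeRel bridge
import Literature.NumberTheory.Automorphic.UnitaryLatticeTreeTypeTwoHyperbolic      -- ★ `UnitaryLatticeTree.eq_one_of_mul_self_eq_one` (`a·a = 1 ⇒ a = 1` in `ℤᵐ⁰`)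
import Summits.HodgeConjecture.HodgeConjecture.Theorems.F0P3cDyRamHSideDescentRatio   -- ★ LH4-p09 (g5): the `Θρ`-fixed root witness `r₀ = μ − μ⁻¹`, `r₀² = jE((t²−4D)t²∕D²)`, its descent
import Summits.HodgeConjecture.HodgeConjecture.Theorems.F0P3cDyRamRamKDiscDepth       -- ★ p858237 LH4-p12 (g5): `discDepth_eq_of_eisenstein` (`dK = d` from a `Θρ`-fixed, `ρ`-anti-fixed root)
import Summits.HodgeConjecture.HodgeConjecture.Theorems.F0P3cDyRamFourthFieldLetters    -- ★ LH4-p09 (g6): `map_ratioWitness_eq_neg` (`ρ r₀ = −r₀`)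
import HarnessLib

/-!
# Crux `H413`, line LH4 «(D-RAM) FOUR-FRAME» — the (ρ2b′-X) road, bottom socket (B): NO INERT DATUM WHEN `Θ` IS RESIDUALLY TRIVIAL

Cell `hodgecm-mathlib` (D-0151), FLOOR 0, crux item H413 = `stmt-HodgeConjecture-24833`; squad F0∕P3c∕LH4; bottom socket (B) «U-ramK» (dealer MAP v3, payer LH4-p14,
lead LH4-p07).  The H-side organ ★ `hSide_closedForm_of_tube_exists` returns a disjunction INERT ∨ EISENSTEIN for the descent datum `Δ_G = (u² + 4w)·z²` of the
`U(Φ₂)`-block; socket (B)'s right-hand side is the EISENSTEIN law, so the (B) composition must refute the INERT disjunct (LH4-p07 (g7) seam (S-sel)).  This file is the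
type-(B) twin of ★ LH4-p11 `F0P3cDyRamTypeASelector.not_eisensteinDatum_typeA`.

THE ARGUMENT (elementary, one place; no completeness, no ramification theory).  Tower `F →ι E →jE M`; `σ` on `E` with `σ ∘ ι = ι`; `ρ, Θ` ring maps of `M` with `Fix ρ = jE(E)`
and `Θ ∘ jE = jE ∘ σ`; TYPE (B): `Θ` is RESIDUALLY TRIVIAL, `|z − Θz| < 1` for `|z| ≤ 1` (★ LH4-p12 `ramK_frame_at_place'`, from the letters `|α − ρα| = 1`, `|α − Θα| < 1`).
The eigenvalue `λ` of the block `U` (`λ² = jE t·λ − jE D`, `ρλ = jE t − λ`, `Θλ·λ = 1`, `t = tr U ≠ 0` — we are near `1` —, no root of `x² − t x + D` in `E`) descends as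
`diag(1, α_H)·U·diag(1, α_H)⁻¹ = s·ι(G)`, so `μ := λ ∕ jE s` is a root of `X² − tr G·X + det G` read in `M`, a polynomial FIXED by `Θ`; hence `Θμ ∈ {μ, tr G − μ}`.
* If `Θμ = μ` then `Θλ·λ = 1` gives `λ² = jE(s ∕ σs) ∈ jE(E)`, so `(ρλ)² = λ²`, and `ρλ ≠ λ` (type 2) forces `ρλ = −λ`, i.e. `t = 0` — excluded.
* If `Θμ = tr G − μ`, put `θ := (2μ − tr G) ∕ ι z`: then `Θθ = −θ` and `θ² = ι(u² + 4w)`; an INERT datum has `|u² + 4w| = 1` (`d_K = 0`) and `u, w ∈ 𝒪`, so `|θ| = 1` and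
  `ν := (θ − ιu) ∕ 2` is a root of the monic integral `X² + uX − w`, whence `|ν| ≤ 1`; but `ν − Θν = θ` has valuation `1`, contradicting residual triviality of `Θ`.
(In words: on type (B) the eigen-field `F(μ) = Fix(Θρ)` of the block is the RAMIFIED quadratic subfield of `M ∕ F` other than `E`, so the `SL₂`-torus datum of the descent is
never inert.)
* §1 one valued-field lemma (`v_le_one_of_quadratic_root`: roots of monic integral quadratics are integral).
* §2 `not_inertDatum_typeB` — the kill in `M`-valuation letters (`|jE ι u| ≤ 1`, `|jE ι w| ≤ 1`, `|jE ι (u² + 4w)| = 1`); only `M` needs a valuation.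
* §3 `not_inertDatum_typeB_of_organ` — the same in the letters of ★ `hSide_closedForm_of_tube_exists`'s INERT disjunct (`u w ∈ 𝒪[F]` of the valuative relation,
  `valuation F (u² + 4w) = valuation F ϖ_F ^ d_K`, `d_K = 0`) along `|ι y| = |y|²` (`e(E∕F) = 2`) and `|jE a| = |a|` (`e(M∕E) = 1`, type U).
* §4 `discDepth_eq_typeB_of_organ` — the companion seam (S-dK) «`d_K = d`» at the SAME letters: ★ LH4-p12 `discDepth_eq_of_eisenstein` fed with ★ LH4-p09's root witness
  `r₀ = μ − μ⁻¹` (`μ = λ∕ρλ`; `Θ(ρ r₀) = r₀`, `ρ r₀ = −r₀`, `r₀² = jE ι((u² + 4w)·(z·tr G∕det G)²)`) and the `ValuativeRel ↔ Valued` bridge for the EISENSTEIN letters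
  `valuation F w = valuation F ϖ_F`, `valuation F (u² + 4w) = valuation F ϖ_F ^ d_K`.
THEOREMS ONLY (no `def`, no instance, no notation, no `sorry`, default heartbeats); lane `--supports stmt-HodgeConjecture-24833 --as helper` (count-neutral).
HONEST LABEL.  Count-neutral; nothing printed is asserted; (ρ2b′-X) stays OPEN; `HC_CM` is proved only modulo the 7 printed citations (2 remaining named inputs: hLiu418 =
`stmt-HodgeConjecture-24832`, h413 = `stmt-HodgeConjecture-24833`) until rung 0 closes.

## References
* [Serre1979] J.-P. Serre, *Local Fields*, GTM 67 (1979), Ch. I §6 Prop. 15, 17 (unramified ∕ Eisenstein quadratic data), Ch. II §2 (integrality of roots of monic integral polynomials).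
* [LabesseLanglands1979] J.-P. Labesse, R. P. Langlands, *L-indistinguishability for SL(2)*, Canad. J. Math. 31 (1979), §2 p. 8 (the tori `T` of `SL(2)` by quadratic data).
* [Rogawski1990] J. D. Rogawski, *Automorphic Representations of Unitary Groups in Three Variables*, Ann. of Math. Stud. 123 (1990), §4.9 p. 55 (the eigen-field of a type-(2) element).
-/

set_option autoImplicit false

noncomputable section

open scoped WithZero
open WithZero

namespace Summit.HodgeConjecture.HodgeConjecture.Cruxes.H413.F0P3cDyRamTypeBSelector

open Literature.NumberTheory.Automorphic Literature.NumberTheory.Automorphic.UnitaryGroup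

/-! ## §1 A valued-field lemma -/

section Valued

variable {K : Type*} [Field K] [Valued K ℤᵐ⁰]

/-- **A root of a monic quadratic with integral coefficients is integral**: `|a| ≤ 1`, `|b| ≤ 1`, `x² + a x + b = 0` ⇒ `|x| ≤ 1` (if `|x| > 1` the term `x²` dominates).
[cite: Serre1979, Ch. II §2] -/
theorem v_le_one_of_quadratic_root {a b x : K} (ha : Valued.v a ≤ 1) (hb : Valued.v b ≤ 1) (hx : x * x + a * x + b = 0) :
    Valued.v x ≤ 1 := by
  by_contra h
  have h1 : 1 < Valued.v x := not_le.1 h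
  have hx0 : Valued.v x ≠ 0 := ne_of_gt (lt_trans zero_lt_one h1)
  have hxx : Valued.v x < Valued.v (x * x) := by
    rw [Valuation.map_mul, ← exp_log hx0, ← exp_add, exp_lt_exp]
    rw [← exp_log hx0, ← exp_zero, exp_lt_exp] at h1
    omega
  have hax : Valued.v (a * x) < Valued.v (x * x) := by
    refine lt_of_le_of_lt ?_ hxx
    rw [Valuation.map_mul]
    exact mul_le_of_le_one_left' ha
  have hbx : Valued.v b < Valued.v (x * x) := lt_of_le_of_lt (hb.trans h1.le) hxx
  have hsum : Valued.v (a * x + b) < Valued.v (x * x) := (Valuation.map_add _ _ _).trans_lt (max_lt hax hbx)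
  have hne : Valued.v (x * x + (a * x + b)) ≠ 0 := by
    rw [Valuation.map_add_eq_of_lt_left _ hsum, Valuation.map_mul]
    exact mul_ne_zero hx0 hx0
  rw [← add_assoc, hx, map_zero] at hne
  exact hne rfl

end Valued

/-! ## §2 THE TYPE-(B) BRANCH KILL (generic tower `F →ι E →jE M`; only `M` carries a valuation) -/

section Kill

open Matrix
open scoped Matrix

variable {F E M : Type*} [Field F] [Field E] [Field M] [Valued M ℤᵐ⁰]

/-- **ON TYPE (B) THE DESCENT DATUM OF THE `U(Φ₂)`-BLOCK IS NOT INERT.**  Tower `F →ι E →jE M`, `σ ∘ ι = ι`, `Fix ρ = jE(E)`, `Θ ∘ jE = jE ∘ σ`, `Θ` RESIDUALLY TRIVIAL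
(`|z − Θz| < 1` on `|z| ≤ 1`: type (B), ★ `ramK_frame_at_place'`), `2 ≠ 0`; the eigenvalue `lam` (`lam² = jE t·lam − jE D`, `ρlam = jE t − lam`, `Θlam·lam = 1`) of a block `U`
(`tr U = t ≠ 0`, `det U = D`, `x² − t x + D` without root in `E`) descending as `diag(1, α_H)·U·diag(1, α_H)⁻¹ = s·ι(G)`; then NO datum `(u² + 4w)·z² = tr²G − 4det G`,
`z ≠ 0`, with `|jE ι u| ≤ 1`, `|jE ι w| ≤ 1`, `|jE ι (u² + 4w)| = 1` exists.  See the module docstring for the two-case argument (`Θμ = μ` ⇒ `t = 0`; `Θμ = tr G − μ` ⇒ the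
integral root `ν = (θ − ιu)∕2`, `θ = (2μ − tr G)∕ιz`, has `|ν − Θν| = |θ| = 1`).  This refutes the INERT disjunct of ★ `hSide_closedForm_of_tube_exists` on socket (B).
[cite: Serre1979, Ch. I §6 Prop. 15, 17; Ch. II §2] [cite: LabesseLanglands1979, §2 p. 8] [cite: Rogawski1990, §4.9 p. 55] -/
theorem not_inertDatum_typeB (ι : F →+* E) (σ : E →+* E) (hσι : ∀ y, σ (ι y) = ι y)
    (jE : E →+* M) (ρ Θ : M →+* M) (hjfix : ∀ z, ρ z = z ↔ ∃ a, jE a = z) (hΘj : ∀ a, Θ (jE a) = jE (σ a))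
    (hΘres : ∀ z : M, Valued.v z ≤ 1 → Valued.v (z - Θ z) < 1) (h2 : (2 : M) ≠ 0)
    {t D : E} {lam : M} (hlam2 : lam * lam = jE t * lam - jE D) (hρlam : ρ lam = jE t - lam) (hΘlam : Θ lam * lam = 1)
    (hirr : ∀ x : E, x * x - t * x + D ≠ 0) (ht0 : t ≠ 0)
    {U : Matrix (Fin 2) (Fin 2) E} (hUt : U.trace = t) (hUD : U.det = D)
    {αH s : E} {G : Matrix (Fin 2) (Fin 2) F} (hα0 : αH ≠ 0) (hs : s ≠ 0)
    (hsg : Matrix.diagonal ![1, αH] * U * Matrix.diagonal ![1, αH⁻¹] = s • G.map ι)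
    {u w z : F} (hz : z ≠ 0) (hD : (u ^ 2 + 4 * w) * z ^ 2 = G.trace ^ 2 - 4 * G.det)
    (hu1 : Valued.v (jE (ι u)) ≤ 1) (hw1 : Valued.v (jE (ι w)) ≤ 1) (hΔ1 : Valued.v (jE (ι (u ^ 2 + 4 * w))) = 1) : False := by
  -- the maps on the bottom field: `ρ` fixes `jE(E)`, `Θ` fixes `jE ι(F)`
  have hρj : ∀ a : E, ρ (jE a) = jE a := fun a => (hjfix (jE a)).2 ⟨a, rfl⟩
  have hΘι : ∀ y : F, Θ (jE (ι y)) = jE (ι y) := fun y => by rw [hΘj, hσι]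
  -- non-vanishing letters
  have hjs0 : jE s ≠ 0 := (map_ne_zero jE).2 hs
  have hσs0 : σ s ≠ 0 := (map_ne_zero σ).2 hs
  have hjσs0 : jE (σ s) ≠ 0 := (map_ne_zero jE).2 hσs0
  have hZ0 : jE (ι z) ≠ 0 := (map_ne_zero jE).2 ((map_ne_zero ι).2 hz)
  have h4 : (4 : M) ≠ 0 := by
    rw [show (4 : M) = 2 * 2 by norm_num]; exact mul_ne_zero h2 h2
  -- type (2): `ρ lam ≠ lam`
  have hρlamne : ρ lam ≠ lam := by
    intro h
    obtain ⟨a, ha⟩ := (hjfix lam).1 h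
    refine hirr a (jE.injective ?_)
    rw [map_zero, map_add, map_sub, map_mul, map_mul, ha]
    linear_combination hlam2
  -- the descent: `t = s·ι tr G`, `D = s²·ι det G`
  have htr : t = s * ι G.trace := by rw [← hUt]; exact trace_eq_smul_of_descent ι hα0 hsg
  have hdet : D = s ^ 2 * ι G.det := by rw [← hUD]; exact det_eq_smul_of_descent ι hα0 hsg
  -- `μ := lam ∕ jE s` is a root of `X² − tr G·X + det G` (read in `M`), and so is `Θ μ`
  obtain ⟨μ, hlamμ⟩ : ∃ μ : M, lam = μ * jE s := ⟨lam / jE s, (div_mul_cancel₀ lam hjs0).symm⟩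
  have hμ2 : μ * μ - jE (ι G.trace) * μ + jE (ι G.det) = 0 := by
    have h := hlam2
    rw [htr, hdet, map_mul, map_mul, map_pow, hlamμ] at h
    have h' : jE s ^ 2 * (μ * μ - jE (ι G.trace) * μ + jE (ι G.det)) = 0 := by linear_combination h
    exact (mul_eq_zero.1 h').resolve_left (pow_ne_zero 2 hjs0)
  have hΘμ2 : Θ μ * Θ μ - jE (ι G.trace) * Θ μ + jE (ι G.det) = 0 := by
    have h := congrArg Θ hμ2
    rwa [map_zero, map_add, map_sub, map_mul, map_mul, hΘι, hΘι] at h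
  have hcases : Θ μ = μ ∨ Θ μ = jE (ι G.trace) - μ := by
    have h : (Θ μ - μ) * (Θ μ - (jE (ι G.trace) - μ)) = 0 := by linear_combination hΘμ2 - hμ2
    rcases mul_eq_zero.1 h with h | h
    · exact Or.inl (sub_eq_zero.1 h)
    · exact Or.inr (sub_eq_zero.1 h)
  rcases hcases with hfix | hflip
  · -- CASE `Θμ = μ`: `lam² = jE(s ∕ σs)` is `ρ`-fixed, so `(ρlam)² = lam²`, `ρlam = −lam`, `t = 0`
    have hΘlam' : Θ lam = μ * jE (σ s) := by rw [hlamμ, map_mul, hfix, hΘj]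
    have h1 : μ * jE (σ s) * lam = 1 := by rw [← hΘlam']; exact hΘlam
    rw [hlamμ] at h1
    have hsq : lam * lam = jE (s / σ s) := by
      rw [map_div₀, eq_div_iff hjσs0, hlamμ]
      linear_combination (jE s) * h1
    have hρsq : ρ lam * ρ lam = lam * lam := by rw [← map_mul, hsq, hρj]
    have h : (ρ lam - lam) * (ρ lam + lam) = 0 := by linear_combination hρsq
    rcases mul_eq_zero.1 h with h | h
    · exact hρlamne (sub_eq_zero.1 h)
    · have ht : jE t = 0 := by linear_combination h - hρlam
      exact ht0 ((map_eq_zero jE).1 ht)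
  · -- CASE `Θμ = tr G − μ`: `θ·ιz = 2μ − tr G`, `Θθ = −θ`, `θ² = ι(u² + 4w)`, `|θ| = 1`
    obtain ⟨θ, hθ⟩ : ∃ θ : M, θ * jE (ι z) = 2 * μ - jE (ι G.trace) :=
      ⟨(2 * μ - jE (ι G.trace)) / jE (ι z), div_mul_cancel₀ _ hZ0⟩
    have hΘθ : Θ θ = -θ := by
      have h := congrArg Θ hθ
      rw [map_mul, hΘι, map_sub, map_mul, map_ofNat, hflip, hΘι] at h
      have h' : (Θ θ + θ) * jE (ι z) = 0 := by linear_combination h + hθ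
      exact eq_neg_of_add_eq_zero_left ((mul_eq_zero.1 h').resolve_right hZ0)
    have hDM : jE (ι (u ^ 2 + 4 * w)) * jE (ι z) ^ 2 = jE (ι G.trace) ^ 2 - 4 * jE (ι G.det) := by
      have h := congrArg (fun y => jE (ι y)) hD
      simp only [map_mul, map_pow, map_sub, map_ofNat] at h
      simpa only [map_add, map_mul, map_pow, map_ofNat] using h
    have hθ2 : θ * θ = jE (ι (u ^ 2 + 4 * w)) := by
      have h : (θ * θ - jE (ι (u ^ 2 + 4 * w))) * jE (ι z) ^ 2 = 0 := by
        linear_combination (θ * jE (ι z) + 2 * μ - jE (ι G.trace)) * hθ + 4 * hμ2 - hDM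
      exact sub_eq_zero.1 ((mul_eq_zero.1 h).resolve_right (pow_ne_zero 2 hZ0))
    have hvθ : Valued.v θ = 1 := by
      have h : Valued.v θ * Valued.v θ = 1 := by rw [← Valuation.map_mul, hθ2, hΔ1]
      exact UnitaryLatticeTree.eq_one_of_mul_self_eq_one h
    -- `ν := (θ − ιu) ∕ 2` is an integral root of `X² + uX − w` with `ν − Θν = θ`
    obtain ⟨ν, hν⟩ : ∃ ν : M, 2 * ν = θ - jE (ι u) :=
      ⟨(θ - jE (ι u)) / 2, by rw [mul_comm]; exact div_mul_cancel₀ _ h2⟩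
    have hν2 : ν * ν + jE (ι u) * ν + (-(jE (ι w))) = 0 := by
      have hsum : jE (ι (u ^ 2 + 4 * w)) = jE (ι u) ^ 2 + 4 * jE (ι w) := by
        simp only [map_add, map_mul, map_pow, map_ofNat]
      have h : 4 * (ν * ν + jE (ι u) * ν + (-(jE (ι w)))) = 0 := by
        linear_combination (2 * ν + θ + jE (ι u)) * hν + hθ2 + hsum
      exact (mul_eq_zero.1 h).resolve_left h4
    have hν1 : Valued.v ν ≤ 1 := v_le_one_of_quadratic_root hu1 (by rw [Valuation.map_neg]; exact hw1) hν2
    have hνΘ : ν - Θ ν = θ := by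
      have h := congrArg Θ hν
      rw [map_mul, map_ofNat, map_sub, hΘθ, hΘι] at h
      have h' : 2 * (ν - Θ ν) = 2 * θ := by linear_combination hν - h
      exact mul_left_cancel₀ h2 h'
    have hlt := hΘres ν hν1
    rw [hνΘ, hvθ] at hlt
    exact lt_irrefl _ hlt

end Kill

/-! ## §3 The kill in the letters of ★ `hSide_closedForm_of_tube_exists`'s INERT disjunct -/

section Bridge

open Matrix ValuativeRel
open scoped Matrix ValuativeRel

variable {F E M : Type*} [Field F] [Field E] [Field M] [Valued F ℤᵐ⁰] [ValuativeRel F] [(Valued.v : Valuation F ℤᵐ⁰).Compatible]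
  [Valued E ℤᵐ⁰] [Valued M ℤᵐ⁰]

/-- **(S-sel) — THE TYPE-(B) BRANCH KILL IN THE ORGAN'S LETTERS.**  As `not_inertDatum_typeB`, with the datum letters exactly as delivered by the INERT disjunct of ★
`hSide_closedForm_of_tube_exists` (`u ∈ 𝒪[F]`, `w ∈ 𝒪[F]` for the valuative relation of `F`, `valuation F (u² + 4w) = valuation F ϖ_F ^ d_K` and `d_K = 0`), transported to
`M` along `|ι y| = |y|²` (`e(E∕F) = 2`, ★ `valued_toPlace_eq_pow_two_of_ramified`) and `|jE a| = |a|` (type U, ★ `ramK_frame_at_place'`); `2 ≠ 0` is asked in `E`.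
At LH4-p07 (g7)'s seam: `not_inertDatum_typeB_of_organ (toPlace v w) hι2 _ hσι ιw hjv1 ρ' Θ hjfix hΘj hΘres h20 hlam2 hρlam hΘlam hirr' ht0 rfl rfl hαH0 hsH hdesc hz hdisc
huτ hin.1 hdK hin.2.2.1` (`hι2`, `hσι`, `hαH0`, `ht0` as in LH4-p11's (A) head: ★ `valued_toPlace_eq_pow_two_of_ramified`, ★ `galAdicCompletionMap_toPlace`, `|αH| ∈ {1, exp(−1)}`,
`|tr| = |2| ≠ 0`).
[cite: Serre1979, Ch. I §6 Prop. 15, 17; Ch. II §2] [cite: LabesseLanglands1979, §2 p. 8] [cite: Rogawski1990, §4.9 p. 55] -/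
theorem not_inertDatum_typeB_of_organ (ι : F →+* E) (hι2 : ∀ y, Valued.v (ι y) = Valued.v y ^ 2) (σ : E →+* E) (hσι : ∀ y, σ (ι y) = ι y)
    (jE : E →+* M) (hjv : ∀ a, Valued.v (jE a) = Valued.v a) (ρ Θ : M →+* M)
    (hjfix : ∀ z, ρ z = z ↔ ∃ a, jE a = z) (hΘj : ∀ a, Θ (jE a) = jE (σ a))
    (hΘres : ∀ z : M, Valued.v z ≤ 1 → Valued.v (z - Θ z) < 1) (h2E : (2 : E) ≠ 0)
    {t D : E} {lam : M} (hlam2 : lam * lam = jE t * lam - jE D) (hρlam : ρ lam = jE t - lam) (hΘlam : Θ lam * lam = 1)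
    (hirr : ∀ x : E, x * x - t * x + D ≠ 0) (ht0 : t ≠ 0)
    {U : Matrix (Fin 2) (Fin 2) E} (hUt : U.trace = t) (hUD : U.det = D)
    {αH s : E} {G : Matrix (Fin 2) (Fin 2) F} (hα0 : αH ≠ 0) (hs : s ≠ 0)
    (hsg : Matrix.diagonal ![1, αH] * U * Matrix.diagonal ![1, αH⁻¹] = s • G.map ι)
    {u w z : F} (hz : z ≠ 0) (hD : (u ^ 2 + 4 * w) * z ^ 2 = G.trace ^ 2 - 4 * G.det)
    (hu : u ∈ 𝒪[F]) (hw : w ∈ 𝒪[F]) {ϖF : F} {dK : ℕ} (hdK : valuation F (u ^ 2 + 4 * w) = valuation F ϖF ^ dK) (hdK0 : dK = 0) : False := by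
  have htr : ∀ y : F, Valued.v (jE (ι y)) = Valued.v y ^ 2 := fun y => by rw [hjv, hι2]
  have h2 : (2 : M) ≠ 0 := by rw [← map_ofNat jE 2]; exact (map_ne_zero jE).2 h2E
  refine not_inertDatum_typeB ι σ hσι jE ρ Θ hjfix hΘj hΘres h2 hlam2 hρlam hΘlam hirr ht0 hUt hUD hα0 hs hsg hz hD ?_ ?_ ?_
  · rw [htr]; exact pow_le_one₀ zero_le ((v_le_one_iff_mem_integer u).2 hu)
  · rw [htr]; exact pow_le_one₀ zero_le ((v_le_one_iff_mem_integer w).2 hw)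
  · rw [hdK0, pow_zero] at hdK
    rw [htr, (v_eq_one_iff_valuation_eq_one _).2 hdK, one_pow]

end Bridge

/-! ## §4 The companion seam (S-dK): `d_K = d` at the same letters (★ LH4-p12 `discDepth_eq_of_eisenstein` ∘ ★ LH4-p09's root witness) -/

section BridgeDK

open Matrix ValuativeRel
open scoped Matrix ValuativeRel
open Literature.NumberTheory.Automorphic.UnitaryThreeFourFrame
open Summit.HodgeConjecture.HodgeConjecture.Cruxes.H413.F0P3cDyRamHSideDescentRatio

variable {F E M : Type} [Field F] [Field E] [Field M] [Valued F ℤᵐ⁰] [ValuativeRel F] [(Valued.v : Valuation F ℤᵐ⁰).Compatible]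
  [Valued E ℤᵐ⁰] [Valued M ℤᵐ⁰]

/-- **(S-dK) — `d_K = d` ON TYPE (B), IN THE ORGAN'S LETTERS.**  Tower `F →ι E →jE M` (`|ι y| = |y|²`, `σ ∘ ι = ι`, `|jE a| = |a|`, `Fix ρ = jE(E)`, `Θ ∘ jE = jE ∘ σ`, `ρ, Θ`
commuting involutions, `ρ` isometric), `Θ` carrying a ramified quadratic datum of depth `d` on `M` (★ `ramK_frame_at_place'`'s `IsRamifiedQuadraticDatum Θ (jE ϖ) d tE`), `2 ≠ 0` in
`E`; the eigen-package `lam² = jE t·lam − jE D`, `ρlam = jE t − lam`, `Θlam·lam = 1`, `D·σD = 1`, `t ≠ 0` of the block `U` (`tr U = t`, `det U = D`) descending as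
`diag(1, α_H)·U·diag(1, α_H)⁻¹ = s·ι(G)` (`det G ≠ 0`); an EISENSTEIN datum `(u² + 4w)·z² = tr²G − 4det G`, `z ≠ 0`, `valuation F w = valuation F ϖ_F` (`|ϖ_F| = exp(−1)`)
with `valuation F (u² + 4w) = valuation F ϖ_F ^ d_K`.  THEN `d_K = d` — ★ LH4-p12 `discDepth_eq_of_eisenstein` at `j := jE ∘ ι` with the root witness `r₀ = μ − μ⁻¹`
(`Θ(ρ r₀) = r₀` ★ `map_map_ratioWitness_eq`, `ρ r₀ = −r₀` ★ `FourthFieldLetters.map_ratioWitness_eq_neg`, `r₀² = j((u² + 4w)·(z·tr G∕det G)²)` ★ `ratioWitness_sq_eq` ∘ ★ `disc_mul_sq_eq` ∘ ★ `discTraceSqDivDetSq_eq_map_of_descent`).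
At LH4-p07 (g7)'s seam: `discDepth_eq_typeB_of_organ (toPlace v w) hι2 _ hσι ιw hjv1 ρ' Θ hρρ hvρ hjfix hΘj hΘΘ hΘρ h20 hDΘ hlam2 hρlam hΘlam hDσ ht0 rfl rfl hαH0 hsH hdesc
(Matrix.GeneralLinearGroup.det_ne_zero g) hz hdisc (HeckeCharacter.valued_uniformizer v) hwτ1 hdK`.
[cite: Serre1979, Ch. I §6 Prop. 17–18; Ch. III §4 Prop. 8] [cite: LabesseLanglands1979, §2 pp. 7–8] [cite: Rogawski1990, §4.9 p. 55, Lemma 4.9.3 p. 56] -/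
theorem discDepth_eq_typeB_of_organ (ι : F →+* E) (hι2 : ∀ y, Valued.v (ι y) = Valued.v y ^ 2) (σ : E →+* E) (hσι : ∀ y, σ (ι y) = ι y)
    (jE : E →+* M) (hjv : ∀ a, Valued.v (jE a) = Valued.v a) (ρ Θ : M →+* M)
    (hρρ : ∀ z, ρ (ρ z) = z) (hvρ : ∀ z, Valued.v (ρ z) = Valued.v z) (hjfix : ∀ z, ρ z = z ↔ ∃ a, jE a = z)
    (hΘj : ∀ a, Θ (jE a) = jE (σ a)) (hΘΘ : ∀ z, Θ (Θ z) = z) (hΘρ : ∀ z, Θ (ρ z) = ρ (Θ z)) (h2E : (2 : E) ≠ 0)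
    {ϖM : M} {d tE : ℕ} (hDΘ : IsRamifiedQuadraticDatum Θ ϖM d tE)
    {t D : E} {lam : M} (hlam2 : lam * lam = jE t * lam - jE D) (hρlam : ρ lam = jE t - lam) (hΘlam : Θ lam * lam = 1)
    (hDσ : D * σ D = 1) (ht0 : t ≠ 0)
    {U : Matrix (Fin 2) (Fin 2) E} (hUt : U.trace = t) (hUD : U.det = D)
    {αH s : E} {G : Matrix (Fin 2) (Fin 2) F} (hα0 : αH ≠ 0) (hs : s ≠ 0)
    (hsg : Matrix.diagonal ![1, αH] * U * Matrix.diagonal ![1, αH⁻¹] = s • G.map ι) (hG : G.det ≠ 0)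
    {u w z : F} (hz : z ≠ 0) (hD : (u ^ 2 + 4 * w) * z ^ 2 = G.trace ^ 2 - 4 * G.det)
    {ϖF : F} (hϖF : Valued.v ϖF = exp (-1 : ℤ)) (hw : valuation F w = valuation F ϖF)
    {dK : ℕ} (hdK : valuation F (u ^ 2 + 4 * w) = valuation F ϖF ^ dK) : dK = d := by
  -- non-vanishing letters
  have hlam0 : lam ≠ 0 := fun h => by rw [h, mul_zero] at hΘlam; exact zero_ne_one hΘlam
  have hD0 : D ≠ 0 := fun h => by rw [h, zero_mul] at hDσ; exact zero_ne_one hDσ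
  have hGt : G.trace ≠ 0 := by
    intro h0
    have h := trace_eq_smul_of_descent ι hα0 hsg
    rw [hUt, h0, map_zero, mul_zero] at h
    exact ht0 h
  have hρj : ∀ a : E, ρ (jE a) = jE a := fun a => (hjfix (jE a)).2 ⟨a, rfl⟩
  have h2 : (2 : M) ≠ 0 := by rw [← map_ofNat jE 2]; exact (map_ne_zero jE).2 h2E
  -- ★ LH4-p09: the root witness `r₀ = μ − μ⁻¹`, `μ = lam∕ρlam`
  have hτr : Θ (ρ (lam / ρ lam - (lam / ρ lam)⁻¹)) = lam / ρ lam - (lam / ρ lam)⁻¹ :=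
    map_map_ratioWitness_eq ρ Θ hΘlam hΘρ hρρ hlam0
  have hρr : ρ (lam / ρ lam - (lam / ρ lam)⁻¹) = -(lam / ρ lam - (lam / ρ lam)⁻¹) :=
    F0P3cDyRamFourthFieldLetters.map_ratioWitness_eq_neg ρ hρρ lam
  have hr : (lam / ρ lam - (lam / ρ lam)⁻¹) ^ 2 = (jE.comp ι) ((u ^ 2 + 4 * w) * (z * G.trace / G.det) ^ 2) := by
    rw [ratioWitness_sq_eq jE ρ hlam2 hρlam hD0 hlam0, RingHom.comp_apply, disc_mul_sq_eq hD hG,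
      ← discTraceSqDivDetSq_eq_map_of_descent ι hα0 hs hsg hG, hUt, hUD]
  -- the EISENSTEIN letters in `Valued` form (★ bridge)
  have hw' : Valued.v w = Valued.v ϖF := (v_eq_iff_valuation_eq w ϖF).2 hw
  have hdK' : Valued.v (u ^ 2 + 4 * w) = Valued.v ϖF ^ dK := by
    rw [← Valuation.map_pow, v_eq_iff_valuation_eq, Valuation.map_pow]; exact hdK
  -- ★ LH4-p12 at `j := jE ∘ ι`
  exact F0P3cDyRamRamKDiscDepth.discDepth_eq_of_eisenstein (jE.comp ι) ρ Θ
    (fun y => by rw [RingHom.comp_apply, hjv, hι2]) (fun y => by rw [RingHom.comp_apply, hρj])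
    (fun y => by rw [RingHom.comp_apply, hΘj, hσι]) hvρ hΘΘ hDΘ h2 rfl (div_ne_zero (mul_ne_zero hz hGt) hG) hϖF hw' hρr hτr hr hdK'

end BridgeDK

end Summit.HodgeConjecture.HodgeConjecture.Cruxes.H413.F0P3cDyRamTypeBSelector

end
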